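import Literature.AlgebraicGeometry.Frobenioids.MonoidFunctorsOnD
import Literature.AnabelianGeometry.EtaleTheta.Discharge.Sec3Thm37Holds

/-!
# [EtTh] Def 3.6 (ii): the rational-function monoid `B` is a monoid on `D` — the residual datum `hBmon`
# reduced to two printed structural facts; "the tempered Frobenioid is a Frobenioid" thereafter

S. Mochizuki, *The étale theta function …*, Publ. RIMS **45** (2009) [MochizukiEtTh2009], Def 3.6 (ii),
PDF p.77: "the data `(D, Φ, B, B → Φ^gp)` determines a model Frobenioid `C` [cf. [FrdI], Theorem 5.2,
(ii)]".  [FrdI] Thm 5.2 presupposes that `B` is a (group-like) MONOID ON `D` in the sense of [FrdI]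
Def 1.1 (ii): (a) pull-backs `B(α)` characteristically injective, (b) bijective along FSM-morphisms.
The discharge files `Sec3Thm37SubQFT` / `Sec3Thm37Holds` (abc-iut-L1-t1, abc-iut-L6-t13) obtain
"`C → F_Φ` is a Frobenioid" at the canonical vocabulary MODULO that one datum
`hBmon : IsMonoidOn C₀.ratFnFunctor`.  Owner's analysis (abc-iut-L2-t3, gen 2) of `hBmon` for
`B = B₀^Λ|_D ×_{(Φ^{ℝ-log})^gp} Φ^gp`:

* (a) holds as soon as the pull-backs of the Def 3.6 (i) datum `B₀^Λ` are injective (`hBinj`) — print: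
  `B₀(Y^log) := lim Mero(Z^log_∞)^{Gal(Z^log_∞/Y^log)}` (Def 3.3 (iii), p.73), whose transition maps are
  INCLUSIONS of invariants — together with the injectivity of `Φ(α)` (`Φ` is a divisorial monoid on `D`,
  field `isDivisorialOn`) on the cancellative `Φ(A)`; the "characteristic" half is vacuous because `B(A)`
  is group-like (`RealifiedDivisorMonoids.isUnit_BΛ`), so `B(A)^char` is trivial;
* (b) holds as soon as the FSM-morphisms of `D` are isomorphisms (`hFSM`) — print: `D = B^temp(X^log)⁰[𝒟]`,
  a category of transitive `Π^tp_X`-sets, in which monomorphisms are isomorphisms ([SemiAnbd] §3;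
  a fact about the base category, owner abc-iut-L3) — functors carry isomorphisms to bijections.

Hence `isMonoidOn_ratFnFunctor (hBinj) (hFSM)` and **`isFrobenioid_of_structural`: the tempered
Frobenioid IS a Frobenioid ([FrdI] Def 1.3) at the canonical vocabulary, modulo the two structural facts
`hBinj`, `hFSM` only** (both properties of the INPUT data `B₀^Λ` / `D`, dischargeable by any construction of
them; neither is a field of the interfaces, which are constructor-locked).  Proof-only; no definitions.
HONEST FRAMING: refereed pre-IUT material; nothing here bears on [IUTchIII] Cor. 3.12.
-/

namespace Literature.AnabelianGeometry.EtaleTheta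

open CategoryTheory Opposite Literature.AlgebraicGeometry.Frobenioids Function

universe u₀ v₀ u v w

/-- In a commutative monoid all of whose elements are units the monoid of associates is trivial
(`M^char = 1`). [cite: MochizukiFrdI2008, Def. 1.1(i)] -/
theorem subsingleton_associates_of_forall_isUnit {M : Type w} [CommMonoid M] (h : ∀ m : M, IsUnit m) :
    Subsingleton (Associates M) := by
  refine ⟨fun a b => ?_⟩
  obtain ⟨a, rfl⟩ := Associates.mk_surjective a
  obtain ⟨b, rfl⟩ := Associates.mk_surjective b
  rw [Associates.mk_eq_one.mpr (h a), Associates.mk_eq_one.mpr (h b)]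

namespace TemperedFrobenioid

variable {D₀ : Type u₀} [Category.{v₀} D₀] {V : FrdIMonoidStub.{w}}
  {T : RealifiedDivisorMonoids (D₀ := D₀) V} {D : Type u} [Category.{v} D]

section General

variable {VD : FrdICatStub.{u, v, w} D} (C₀ : TemperedFrobenioid T D VD)

/-- The pull-back `B(f)` of the rational-function monoid is injective when `B₀^Λ(Base f)` and
`Φ(f)^gp` are. [cite: MochizukiEtTh2009, Def 3.6 p.77] -/
theorem ratFnPull_injective {A A' : Dᵒᵖ} (f : A ⟶ A')
    (hB : Injective (T.BΛ.map (C₀.base.map f.unop).op).hom) (hΦ : Injective (gpMap (C₀.Φ.pull f))) :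
    Injective (C₀.ratFnPull f) := by
  intro p q h
  have h' := congrArg Subtype.val h
  rw [coe_ratFnPull, coe_ratFnPull] at h'
  obtain ⟨h1, h2⟩ := Prod.mk.inj h'
  exact Subtype.ext (Prod.ext (hB h1) (hΦ h2))

/-- `B(α)` is bijective along an isomorphism `α` of `D` (functoriality). [cite: MochizukiEtTh2009, Def 3.6 p.77] -/
theorem ratFnPull_bijective_of_isIso {A B : D} (α : B ⟶ A) [IsIso α] :
    Bijective (pull C₀.ratFnFunctor α) :=
  (Iso.commMonCatIsoToMulEquiv (C₀.ratFnFunctor.mapIso (asIso α).op)).bijective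

end General

/-! ## At the canonical [FrdI] vocabulary `treeCatVocab` -/

section TreeVocab

variable {IsRational IsStrictlyRational : (Dᵒᵖ ⥤ CommMonCat.{w}) → Prop}
  (C₀ : TemperedFrobenioid T D (treeCatVocab D IsRational IsStrictlyRational))

/-- `Φ(A)` is cancellative (a divisorial monoid is integral). [cite: MochizukiEtTh2009, Def 3.6 p.77] -/
theorem isCancelMul_divisorMonoid (A : D) : IsCancelMul (C₀.Φ.carrier (op A)) :=
  isIntegral_iff_isCancelMul.mp (C₀.isDivisorial_divisorMonoid A).isPreDivisorial.isIntegral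

/-- **`B = B₀^Λ|_D ×_{(Φ^{ℝ-log})^gp} Φ^gp` is a monoid on `D`** ([FrdI] Def 1.1 (ii)) as soon as the
pull-backs of `B₀^Λ` are injective and the FSM-morphisms of `D` are isomorphisms.
[cite: MochizukiEtTh2009, Def 3.6 p.77] -/
theorem isMonoidOn_ratFnFunctor
    (hBinj : ∀ {Y Y' : D₀ᵒᵖ} (g : Y ⟶ Y'), Injective (T.BΛ.map g).hom)
    (hFSM : ∀ {A B : D} (α : B ⟶ A), IsFSM α → IsIso α) : IsMonoidOn C₀.ratFnFunctor where
  isCharInjective {A B} α := by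
    refine ⟨?_, ?_⟩
    · haveI := C₀.isCancelMul_divisorMonoid A
      haveI := C₀.isCancelMul_divisorMonoid B
      exact C₀.ratFnPull_injective α.op (hBinj _)
        (Literature.AlgebraicGeometry.Frobenioids.gpMap_injective (C₀.Φ.pull α.op)
          (C₀.isMonoidOn_divisorMonoid.isCharInjective α).1)
    · have hs : Subsingleton (Associates (C₀.ratFnFunctor.obj (op A))) :=
        subsingleton_associates_of_forall_isUnit fun m => C₀.ratFn_isUnit T.isUnit_BΛ (op A) m
      exact fun a b _ => hs.elim a b
  bijective_of_isFSM α hα := by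
    haveI := hFSM α hα
    exact C₀.ratFnPull_bijective_of_isIso α

/-- **The tempered Frobenioid IS a Frobenioid** ([FrdI] Def 1.3, via L1's proved [FrdI] Thm 5.2 (ii)
`ModelFrobenioid.isFrobenioid`) at the canonical vocabulary, modulo only the two structural facts
`hBinj` (pull-backs of `B₀^Λ` injective) and `hFSM` (FSM-morphisms of `D` are isomorphisms).
[cite: MochizukiEtTh2009, Def 3.6 p.77] -/
theorem isFrobenioid_of_structural
    (hBinj : ∀ {Y Y' : D₀ᵒᵖ} (g : Y ⟶ Y'), Injective (T.BΛ.map g).hom)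
    (hFSM : ∀ {A B : D} (α : B ⟶ A), IsFSM α → IsIso α) :
    PreFrobenioid.IsFrobenioid C₀.toElem :=
  C₀.isFrobenioid_treeCatVocab_of_isMonoidOn (C₀.isMonoidOn_ratFnFunctor hBinj hFSM)

/-- **Thm 3.7 (i)**, tree-vocabulary clauses ("of isotropic type", "of sub-quasi-Frobenius-trivial type",
"not of group-like type"), at the canonical vocabulary modulo `hBinj`, `hFSM` only.
[cite: MochizukiEtTh2009, Thm 3.7 p.79] -/
theorem thm37_i_treeClauses_of_structural
    (hBinj : ∀ {Y Y' : D₀ᵒᵖ} (g : Y ⟶ Y'), Injective (T.BΛ.map g).hom)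
    (hFSM : ∀ {A B : D} (α : B ⟶ A), IsFSM α → IsIso α) :
    PreFrobenioid.IsOfIsotropicType C₀.toElem ∧
      PreFrobenioid.IsOfType (PreFrobenioid.IsSubQuasiFrobeniusTrivial C₀.toElem) ∧
      ¬ PreFrobenioid.IsOfType (PreFrobenioid.IsGroupLikeObj C₀.toElem) :=
  C₀.thm37_i_treeClauses_treeCatVocab_of_isMonoidOn (C₀.isMonoidOn_ratFnFunctor hBinj hFSM)

/-- **Thm 3.7 (iv)** (named `Prop` `Thm37_iv`: "`D` slim ⟹ `C` slim") at the canonical vocabulary modulo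
`hBinj`, `hFSM` and `hdiv` (`⋂ₙ O^×(A)ⁿ = 1`, the unit-profinite or unit-trivial type input).
[cite: MochizukiEtTh2009, Thm 3.7 p.80] -/
theorem thm37_iv_of_structural
    (hBinj : ∀ {Y Y' : D₀ᵒᵖ} (g : Y ⟶ Y'), Injective (T.BΛ.map g).hom)
    (hFSM : ∀ {A B : D} (α : B ⟶ A), IsFSM α → IsIso α)
    (hdiv : ∀ (X : C₀.category) (α : Aut X), α ∈ PreFrobenioid.unitsSubgroup C₀.toElem X →
      (∀ n : ℕ+, ∃ β : Aut X, β ∈ PreFrobenioid.unitsSubgroup C₀.toElem X ∧ β ^ (n : ℕ) = α) → α = 1) :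
    C₀.Thm37_iv :=
  C₀.thm37_iv_treeCatVocab_of_isMonoidOn (C₀.isMonoidOn_ratFnFunctor hBinj hFSM) hdiv

end TreeVocab

end TemperedFrobenioid

end Literature.AnabelianGeometry.EtaleTheta
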